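import Mathlib
import HarnessLib

/-!
# Crux `OddMorawetz.MorawetzKillsTypeI` (stmt-NavierStokesRegularity-1377), line `birth`:
  stub `stub_weightParity` — weight parity of a smooth cubic jet density

A smooth density `m` on 3-jets `z = (z₀, z₁, z₂, z₃)` over `E = ℝ³` which is pointwise
cubic (`m (μ • z) = μ ^ 3 * m z` for ALL real `μ`) is a cubic FORM: differentiating
`μ ↦ m (μ • z)` three times at `μ = 0` gives `6 * m z = D³m(0)[z, z, z]`
(`six_mul_eq_iteratedFDeriv_of_cubic`).  Expanding the trilinear form `D³m(0)` along the
monomial curve `s ↦ (z₀, s • z₁, s² • z₂, s³ • z₃) = ∑ₐ s ^ a • eₐ` by multilinearity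
shows that `s ↦ m (z₀, s • z₁, s² • z₂, s³ • z₃)` is a real polynomial in `s`
(`exists_polynomial_multilinear_monomialCurve`).  If it agrees with `s ^ k * m z` for all
`s > 0` (derivative weight `k` under positive dilations), the two polynomials coincide
(`Polynomial.eq_zero_of_infinite_isRoot`), and evaluating at `s = -1` yields the
weight-parity identity `m (z₀, -z₁, z₂, -z₃) = (-1) ^ k * m z` (`stub_weightParity`).

Elementary; no published source needed (folklore polynomial-identity argument).
Lands `--supports stmt-NavierStokesRegularity-1377`.
-/

noncomputable section

-- the summit and its single problem share the name (D-0017 nested layout)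
set_option linter.dupNamespace false

namespace Summit.NavierStokesRegularity.NavierStokesRegularity.Theorems

open Polynomial

/-- **Cubic homogeneity makes a smooth function a cubic form.** If `m : V → ℝ` is smooth
and `m (μ • z) = μ ^ 3 * m z` for all real `μ`, then `6 * m z = D³m(0)[z, z, z]`, the third
Fréchet derivative of `m` at the origin evaluated on the constant family `(z, z, z)`.
Proof: the chain rule along the linear map `μ ↦ μ • z`
(`ContinuousLinearMap.iteratedFDeriv_comp_right`) and the one-variable computation of the
third derivative of `μ ↦ μ ^ 3 * m z` at `0`, namely `6 * m z`. -/
theorem six_mul_eq_iteratedFDeriv_of_cubic {V : Type*} [NormedAddCommGroup V]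
    [NormedSpace ℝ V] {m : V → ℝ} (hm : ContDiff ℝ (⊤ : ℕ∞) m)
    (hcub : ∀ (μ : ℝ) (z : V), m (μ • z) = μ ^ 3 * m z) (z : V) :
    6 * m z = iteratedFDeriv ℝ 3 m 0 (fun _ => z) := by
  have h3 : ContDiff ℝ (3 : ℕ) m := contDiff_infty.mp hm 3
  have hcomp := (ContinuousLinearMap.toSpanSingleton ℝ z).iteratedFDeriv_comp_right h3 0
    (i := 3) le_rfl
  have hval := congrArg
    (fun T : ContinuousMultilinearMap ℝ (fun _ : Fin 3 => ℝ) ℝ => T fun _ => (1 : ℝ)) hcomp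
  simp only [ContinuousMultilinearMap.compContinuousLinearMap_apply,
    ContinuousLinearMap.toSpanSingleton_apply, one_smul, map_zero] at hval
  rw [← hval, ← iteratedDeriv_eq_iteratedFDeriv]
  have hfun :
      (m ∘ ⇑(ContinuousLinearMap.toSpanSingleton ℝ z)) = fun μ : ℝ => μ ^ 3 * m z := by
    funext μ
    simp [ContinuousLinearMap.toSpanSingleton_apply, hcub]
  rw [hfun, iteratedDeriv_mul_const_field, iteratedDeriv_pow]
  norm_num [Nat.descFactorial]

/-- **Multilinear forms along monomial curves are polynomial.** For a continuous
multilinear form `T` in `ι` variables on `V` and the curve `s ↦ ∑ₐ s ^ d a • e a`, the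
function `s ↦ T (∑ₐ s ^ d a • e a, …, ∑ₐ s ^ d a • e a)` is (the evaluation of) a real
polynomial: expand by multilinearity (`ContinuousMultilinearMap.map_sum`, `map_smul_univ`). -/
theorem exists_polynomial_multilinear_monomialCurve {V : Type*} [NormedAddCommGroup V]
    [NormedSpace ℝ V] {ι α : Type*} [Fintype ι] [Fintype α]
    (T : ContinuousMultilinearMap ℝ (fun _ : ι => V) ℝ) (e : α → V) (d : α → ℕ) :
    ∃ p : ℝ[X], ∀ s : ℝ, T (fun _ => ∑ a, s ^ d a • e a) = p.eval s := by
  classical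
  refine ⟨∑ r : ι → α, C (T fun i => e (r i)) * X ^ (∑ i, d (r i)), fun s => ?_⟩
  rw [ContinuousMultilinearMap.map_sum T fun (_ : ι) (a : α) => s ^ d a • e a]
  simp only [eval_finsetSum, eval_mul, eval_C, eval_pow, eval_X]
  refine Finset.sum_congr rfl fun r _ => ?_
  rw [ContinuousMultilinearMap.map_smul_univ T (fun i => s ^ d (r i)) (fun i => e (r i)),
    Finset.prod_pow_eq_pow_sum, smul_eq_mul, mul_comm]

/-- **Weight parity of a smooth cubic jet density** (stub `stub_weightParity` of the line
`birth` of the crux `OddMorawetz.MorawetzKillsTypeI`).  A smooth pointwise-cubic density `m`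
on 3-jets (`m (μ • z) = μ³ m z` for all real `μ`) whose derivative weight is `k` for
POSITIVE dilations (`m (z₀, s • z₁, s² • z₂, s³ • z₃) = s ^ k * m z`, `s > 0`) has the
weight parity `m (z₀, -z₁, z₂, -z₃) = (-1) ^ k * m z`.  Proof: by
`six_mul_eq_iteratedFDeriv_of_cubic` and `exists_polynomial_multilinear_monomialCurve`,
`s ↦ m (z₀, s • z₁, s² • z₂, s³ • z₃)` is a polynomial in `s`; it agrees with `s ^ k * m z`
on the infinite set `(0, ∞)`, hence everywhere (`Polynomial.eq_zero_of_infinite_isRoot`);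
evaluate at `s = -1`. -/
theorem stub_weightParity :
    ∀ (k : ℕ) (m : EuclideanSpace ℝ (Fin 3) × (EuclideanSpace ℝ (Fin 3) [×1]→L[ℝ] EuclideanSpace ℝ (Fin 3)) × (EuclideanSpace ℝ (Fin 3) [×2]→L[ℝ] EuclideanSpace ℝ (Fin 3)) × (EuclideanSpace ℝ (Fin 3) [×3]→L[ℝ] EuclideanSpace ℝ (Fin 3)) → ℝ),
      ContDiff ℝ (⊤ : ℕ∞) m → (∀ (μ : ℝ) z, m (μ • z) = μ ^ 3 * m z) →
      (∀ (s : ℝ), 0 < s → ∀ (z₀ : EuclideanSpace ℝ (Fin 3))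
          (z₁ : EuclideanSpace ℝ (Fin 3) [×1]→L[ℝ] EuclideanSpace ℝ (Fin 3))
          (z₂ : EuclideanSpace ℝ (Fin 3) [×2]→L[ℝ] EuclideanSpace ℝ (Fin 3))
          (z₃ : EuclideanSpace ℝ (Fin 3) [×3]→L[ℝ] EuclideanSpace ℝ (Fin 3)),
          m (z₀, s • z₁, (s ^ 2) • z₂, (s ^ 3) • z₃) = s ^ k * m (z₀, z₁, z₂, z₃)) →
      ∀ (z₀ : EuclideanSpace ℝ (Fin 3))
        (z₁ : EuclideanSpace ℝ (Fin 3) [×1]→L[ℝ] EuclideanSpace ℝ (Fin 3))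
        (z₂ : EuclideanSpace ℝ (Fin 3) [×2]→L[ℝ] EuclideanSpace ℝ (Fin 3))
        (z₃ : EuclideanSpace ℝ (Fin 3) [×3]→L[ℝ] EuclideanSpace ℝ (Fin 3)),
        m (z₀, -z₁, z₂, -z₃) = (-1 : ℝ) ^ k * m (z₀, z₁, z₂, z₃) := by
  intro k m hm hcub hk z₀ z₁ z₂ z₃
  /- Scalar identities on the multilinear jet components, stated with the instances of the
  signature (generic `simp` lemmas such as `smul_zero`/`neg_one_smul` do not fire on them by
  rewriting, but the term-mode proofs elaborate). -/
  have h01 : ∀ c : ℝ, c • (0 : EuclideanSpace ℝ (Fin 3) [×1]→L[ℝ] EuclideanSpace ℝ (Fin 3)) = 0 :=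
    fun c => smul_zero (A := EuclideanSpace ℝ (Fin 3) [×1]→L[ℝ] EuclideanSpace ℝ (Fin 3)) c
  have h02 : ∀ c : ℝ, c • (0 : EuclideanSpace ℝ (Fin 3) [×2]→L[ℝ] EuclideanSpace ℝ (Fin 3)) = 0 :=
    fun c => smul_zero (A := EuclideanSpace ℝ (Fin 3) [×2]→L[ℝ] EuclideanSpace ℝ (Fin 3)) c
  have h03 : ∀ c : ℝ, c • (0 : EuclideanSpace ℝ (Fin 3) [×3]→L[ℝ] EuclideanSpace ℝ (Fin 3)) = 0 :=
    fun c => smul_zero (A := EuclideanSpace ℝ (Fin 3) [×3]→L[ℝ] EuclideanSpace ℝ (Fin 3)) c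
  -- the four "pure" jets `e = ![(z₀,0,0,0), (0,z₁,0,0), (0,0,z₂,0), (0,0,0,z₃)]`, whose
  -- weighted sum `∑ₐ s ^ a • e a` is the dilated jet
  set e : Fin 4 → EuclideanSpace ℝ (Fin 3)
      × (EuclideanSpace ℝ (Fin 3) [×1]→L[ℝ] EuclideanSpace ℝ (Fin 3))
      × (EuclideanSpace ℝ (Fin 3) [×2]→L[ℝ] EuclideanSpace ℝ (Fin 3))
      × (EuclideanSpace ℝ (Fin 3) [×3]→L[ℝ] EuclideanSpace ℝ (Fin 3)) :=
    ![(z₀, 0, 0, 0), (0, z₁, 0, 0), (0, 0, z₂, 0), (0, 0, 0, z₃)] with he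
  have hw : ∀ s : ℝ,
      (z₀, s • z₁, (s ^ 2) • z₂, (s ^ 3) • z₃) = ∑ a : Fin 4, s ^ (a : ℕ) • e a := by
    intro s
    simp [he, Fin.sum_univ_four, h01, h02, h03]
  -- `s ↦ 6 * m (dilated jet)` is a polynomial `p`
  obtain ⟨p, hp⟩ := exists_polynomial_multilinear_monomialCurve (iteratedFDeriv ℝ 3 m 0) e
    fun a => (a : ℕ)
  have hmw : ∀ s : ℝ,
      6 * m (z₀, s • z₁, (s ^ 2) • z₂, (s ^ 3) • z₃) = p.eval s := by
    intro s
    rw [six_mul_eq_iteratedFDeriv_of_cubic hm hcub, hw s, hp s]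
  -- `p - C (6 * m z) * X ^ k` vanishes on `(0, ∞)`, hence it is the zero polynomial
  have hq : p - C (6 * m (z₀, z₁, z₂, z₃)) * X ^ k = 0 := by
    apply Polynomial.eq_zero_of_infinite_isRoot
    refine (Set.Ioi_infinite (0 : ℝ)).mono fun s hs => ?_
    have h1 := hmw s
    rw [hk s hs] at h1
    simp only [Set.mem_setOf_eq, IsRoot.def, eval_sub, eval_mul, eval_C, eval_pow, eval_X]
    linear_combination -h1
  -- evaluate at `s = -1`
  have hev := congrArg (Polynomial.eval (-1 : ℝ)) hq
  simp only [eval_sub, eval_mul, eval_C, eval_pow, eval_X, eval_zero] at hev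
  have hz1 : (-1 : ℝ) • z₁ = -z₁ := neg_one_smul ℝ z₁
  have hz2 : ((-1 : ℝ) ^ 2) • z₂ = z₂ := by rw [neg_one_sq]; exact one_smul ℝ z₂
  have hz3 : ((-1 : ℝ) ^ 3) • z₃ = -z₃ := by
    rw [show ((-1 : ℝ)) ^ 3 = -1 by norm_num]; exact neg_one_smul ℝ z₃
  have hm1 := hmw (-1)
  rw [hz1, hz2, hz3] at hm1
  linear_combination (hm1 + hev) / 6

end Summit.NavierStokesRegularity.NavierStokesRegularity.Theorems

end
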